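import Summits.CriticalPhenomena.CardyFormulaZ2.Theses.CardyRotToConf
import Literature.Probability.RandomPlanarGeometry.LoewnerImageCurve
import HarnessLib

/-!
# Stub `stub_loewnerImageCurve` of line `germ-label-transport` (crux `stmt-CriticalPhenomena-0698`)

Brick (a) of `stub_isLocal` (LSW locality of SLE₆, restriction form; Lawler–Schramm–Werner (2003)
§5): for a continuous driving function `W` with `W 0 = 0` whose Loewner chain is generated by a
curve `γ`, a nonempty `*`-hull `A` and an alive horizon `β` (`Disjoint (closedHull W β) A`), the
hulls of the conformal-image chain — the Loewner chain of the image driving function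
`Loewner.imageDriverC W A β = W̃ ∘ τ` in capacity time — are filled in by the image curve
`γ̂ = E_A ∘ γ ∘ τ` (`E_A = hullExt (starRMap A hA)`, `τ = Loewner.imageClockInv W A β`):
`Loewner.hull (W̃ ∘ τ) q = ℍ ∖ (unbounded component of ℍ ∖ γ̂[0, q])` for `q < σ β`. The
registered stub signature, an instance of the Literature theorem
`Loewner.hull_imageDriverC_eq_compl_unboundedComponent` (`LoewnerImageCurve.lean`, where the
mathematics lives: `H_t ∖ A` is connected by Janiszewski, `Φ_A` and `Φ_A⁻¹` are `∼ z` at `∞`, so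
the unbounded component of `ℍ ∖ γ̂[0, q]` is `Φ_A(H_t ∖ A)`, `t = τ q`). The registered text writes
`unboundedComponent` unqualified; the selective `open … Loewner (unboundedComponent)` below makes
that name denote the tree's `Literature.Probability.RandomPlanarGeometry.Loewner.unboundedComponent`
(no new declaration).
-/

noncomputable section

open Literature.Probability.RandomPlanarGeometry
open Literature.Probability.RandomPlanarGeometry.Loewner (unboundedComponent)

namespace Summit.CriticalPhenomena.CardyFormulaZ2.Theorems.CardyRotToConfR2SymmetryUpgrade

/-- **(a).** The image chain is generated by the image curve `E_A ∘ γ ∘ τ`: for `q < σ β`,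
`Loewner.hull (imageDriverC W A β) q = ℍ ∖ unboundedComponent (ℍ ∖ γ̂[0, q])`,
`γ̂ r = hullExt (starRMap A hA) (γ (imageClockInv W A β r))`
(`Loewner.hull_imageDriverC_eq_compl_unboundedComponent`).
[cite: LawlerSchrammWerner2003Restriction, §5 (K̃_t = Φ_A(K_t))] -/
theorem stub_loewnerImageCurve : ∀ {W : NNReal → ℝ} {A : Set ℂ}, Continuous W → W 0 = 0 →
    ∀ (hA : IsStarHull A), A.Nonempty → ∀ {β : NNReal}, Disjoint (Loewner.closedHull W β) A →
    ∀ {γ : NNReal → ℂ}, Loewner.IsGeneratedByCurve W γ → ∀ {q : NNReal},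
    (q : ℝ) < Loewner.imageClock W A β → Loewner.hull (Loewner.imageDriverC W A β) q =
    UpperHalfPlane.upperHalfPlaneSet \ unboundedComponent (UpperHalfPlane.upperHalfPlaneSet \
    (fun r : ℝ ↦ hullExt (starRMap A hA) (γ (Loewner.imageClockInv W A β r).toNNReal)) ''
    Set.Icc (0 : ℝ) q) :=
  fun hW hW0 hA hne _ hβ _ hγ _ hq ↦
    Loewner.hull_imageDriverC_eq_compl_unboundedComponent hW hW0 hA hne hβ hγ hq

end Summit.CriticalPhenomena.CardyFormulaZ2.Theorems.CardyRotToConfR2SymmetryUpgrade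

end
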